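import Literature.Analysis.FluidPDE.PressureFreeEpsilonRegularityProofs
import Literature.Analysis.FluidPDE.KwonPerturbedSuitable
import Literature.Analysis.FluidPDE.CKN1982Setting
import HarnessLib

/-!
# Kwon's pressure-free ε-regularity criterion: the §4 assembly (Lemma 2.5 + Thm. 3.1 ⇒ Thm. 1.4)

Analysis/FluidPDE proof file (theorems only; no definitions, no named facts) on the discharge
path of the named fact `Literature.Analysis.FluidPDE.kwon2023_velocity_epsilon_regularity`
(`PressureFreeEpsilonRegularity.lean`; H. Kwon, *The role of the pressure in the regularity
theory for the Navier–Stokes equations*, J. Differential Equations 357 (2023) 1–31 =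
arXiv:2104.03160, Thm. 1.4 with `r = m = 3`, for suitable weak solutions in the classes of
Def. 1.1 / Scheffer, qualitative conclusion `u ∈ L^∞(Q_{ρ/4})`).

The printed proof of Thm. 1.4 (§4, arXiv p. 15) is ten lines: apply **Lemma 2.5** (the
decomposition `u = v + h` on `(−4,0) × B₁` of a dissipative solution on `Q₂` by the localized
Leray projection `v = −curl Δ⁻¹(φ curl u)`; `h` harmonic with
`‖∇ᵏh‖_{L^∞((−t₀,0)×B₁)} ≲_k ‖u‖_{L^∞(−t₀,0;L¹(B₂))}` and
`‖h‖_{L^r_t W^{1,∞}_x(Q₁)} ≲ ‖u‖_{L^r_tL^m_x(Q₂)}`; `v` a suitable weak solution (Def. 2.4) of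
the perturbed system `∂ₜv + (v·∇)v + (v·∇)h + (h·∇)v + ∇q = Δv + f`, `div v = 0` (per.NS) on
`Q₁` with `‖q‖_{L^{r/2}_tL^{m/2}_x(Q₁)} ≲ ‖u‖²_{L^r_tL^m_x(Q₂)}`,
`‖f‖_{L^{r/2}_tL^∞_x(Q₁)} ≲ ‖u‖_{L^r_tL^m_x(Q₂)} + ‖u‖²_{L^r_tL^m_x(Q₂)}` and, by (est.v),
`‖v‖_{L^r_tL^m_x(Q₁)} ≲ ‖u‖_{L^r_tL^m_x(Q₂)}`), so that
`‖v‖ + ‖q‖ + ‖h‖ + ‖f‖ ≤ C₂(‖u‖_{L^r_tL^m_x(Q₂)} + ‖u‖²_{L^r_tL^m_x(Q₂)})`; "hence if we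
choose a positive constant `ε = ε(r,m)` such that `C₂(m)(ε + ε²) ≤ ε₀(r,m)`, where `ε₀(r,m)`
is given by **Theorem 3.1**" (the ε-regularity criterion for suitable weak solutions of
(per.NS) on `Q₁`: `‖v‖_{L^r_tL^m_x(Q₁)} + ‖q‖_{L^{r/2}_tL^{m/2}_x(Q₁)} + ‖h‖_{L^r_tW^{1,∞}_x(Q₁)}
+ ‖f‖_{L^{r/2}_tL^∞_x(Q₁)} ≤ ε₀` implies `‖v‖_{C^α_par(Q_{1/2})} ≤ C`), "we have
`‖v‖_{C^α_par(Q_{1/2})} ≤ C`"; and `u = v + h` with `h` bounded on `Q_{1/2}` by the `L^∞_t`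
form of (est.h).

This file PROVES that assembly in the tree's vocabulary, for the cubic case `r = m = 3` and
the CKN-suitable class of the named fact ("any suitable weak solution is a dissipative
solution", §1 p. 3), with the two printed inputs as HYPOTHESES stated in the tree's vocabulary
(`Kwon2023.IsPerturbedSuitableOn`, `KwonPerturbedSuitable.lean`, is the tree's rendering of
Def. 2.4):

* `kwon2023_unitScale_of_lemma25_of_thm31` — Lemma 2.5 (`r = m = 3`, CKN-suitable class on
  `Q₂(0)`, conclusion on `Q₁(0)`, with the qualitative `L^∞(Q_{1/2}(0))` bound of `h`) and
  Thm. 3.1 (`r = m = 3` on `Q₁(0)`, conclusion weakened to `v ∈ L^∞(Q_{1/2}(0))`, which the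
  printed parabolic-Hölder bound implies) together give the unit-scale statement: every
  suitable weak solution on `Q₂(0)` in the classes of Def. 1.1 with `2⁻²∬_{Q₂}|u|³ ≤ ε` is
  essentially bounded on `Q_{1/2}(0)`, with the printed choice of `ε` (here `ε = η³/4`,
  `η = min(1, ε₀/(2C₁))`, so that `‖u‖_{L³(Q₂)} ≤ η` and `C₁η, C₁η², C₁(η + η²) ≤ ε₀`);
* `kwon2023_velocity_epsilon_regularity_of_lemma25_of_thm31` — composed with the accepted
  scaling reduction `kwon2023_velocity_epsilon_regularity_of_two`
  (`PressureFreeEpsilonRegularityProofs.lean`), the named fact follows from the two printed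
  inputs.

What remains for `kwon2023_velocity_epsilon_regularity_holds` is therefore exactly the two
hypotheses `h25` (Lemma 2.5: space–time assembly of the slice bricks `KwonHarmonicPart`, …,
`KwonSpaceTimeFields`, plus the local energy inequality of `v`, arXiv p. 9) and `h31`
(Thm. 3.1: oscillation Lemma 3.3 by compactness, iteration §3.2, Campanato), neither of which
is in the tree (2026-08-28). No new notion and no named fact is introduced here (D-0026): the
two inputs are binders of the theorems, written out in full. All cylinders are centred at the
space–time origin `0 : ℝ × ℝ³` (`Q_r(0) = (−r², 0) × B_r(0)`).

## Mathlib / tree search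

Reused: `kwon2023_velocity_epsilon_regularity_of_two` (`PressureFreeEpsilonRegularityProofs`),
`Kwon2023.IsPerturbedSuitableOn` (`KwonPerturbedSuitable`), `parabolicCylinder_mono`
(`CKN1982Setting`), the accepted `cknAEss`/`cknC`/`cknD`/`cknE`/`parabolicCylinder(Opens)`/
`IsSuitableWeakSolutionOn`/`HasWeakSpatialGradientOn`. Mathlib: `eLpNorm_congr_ae`,
`eLpNormEssSup_add_le`, `eLpNorm_eq_lintegral_rpow_enorm_toReal`, `ENNReal.inv_mul_le_iff`,
`ae_restrict_of_ae_restrict_of_subset`. `lean search 'kwon2023|lemma25|thm31|Perturbed'`: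
only the fact, its scaling reduction, the definition file and the slice bricks.

## References

* H. Kwon, J. Differential Equations 357 (2023) 1–31 = arXiv:2104.03160: Thm. 1.4 (p. 4),
  Def. 1.1 and §1 p. 3, Def. 2.4 and Lemma 2.5 with (est.q), (est.f), (est.h), (est.v)
  (pp. 7–9), Thm. 3.1 (p. 10), §4 proof of Thm. 1.4 (p. 15). [Kwon2023RolePressure]
* L. Caffarelli, R. Kohn, L. Nirenberg, Comm. Pure Appl. Math. 35 (1982), §2 (2.1)–(2.5).
  [CaffarelliKohnNirenberg1982]
-/

noncomputable section

open MeasureTheory Set Function Filter Topology TopologicalSpace Metric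
open scoped NNReal ENNReal

namespace Literature.Analysis.FluidPDE

/-- `Q_{1/2}(0) ⊆ Q₁(0)`. [folklore] -/
private theorem parabolicCylinder_half_subset_one :
    parabolicCylinder (1 / 2) (0 : ℝ × EuclideanSpace ℝ (Fin 3)) ⊆ parabolicCylinder 1 0 :=
  parabolicCylinder_mono (by norm_num) (by norm_num) _

/-- From the scale-invariant smallness `2⁻²∬_{Q₂(0)}|u|³ ≤ η³/4` to the norm bound
`‖u‖_{L³(Q₂(0))} ≤ η` (`η ≥ 0`). [folklore] -/
private theorem eLpNorm_three_le_of_cknC_two_le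
    {u : ℝ → EuclideanSpace ℝ (Fin 3) → EuclideanSpace ℝ (Fin 3)} {η : ℝ} (hη : 0 ≤ η)
    (hC : cknC 2 (0 : ℝ × EuclideanSpace ℝ (Fin 3)) u ≤ ENNReal.ofReal (η ^ 3 / 4)) :
    eLpNorm (uncurry u) 3
        (volume.restrict (parabolicCylinder 2 (0 : ℝ × EuclideanSpace ℝ (Fin 3)))) ≤
      ENNReal.ofReal η := by
  have h2 : (ENNReal.ofReal 2 ^ 2) ≠ 0 := by positivity
  have h2' : (ENNReal.ofReal 2 ^ 2) ≠ ⊤ := ENNReal.pow_ne_top ENNReal.ofReal_ne_top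
  have hI : ∫⁻ q in parabolicCylinder 2 (0 : ℝ × EuclideanSpace ℝ (Fin 3)),
      ‖u q.1 q.2‖ₑ ^ (3 : ℕ) ≤ ENNReal.ofReal η ^ (3 : ℕ) := by
    unfold cknC at hC
    rw [ENNReal.inv_mul_le_iff h2 h2'] at hC
    refine hC.trans (le_of_eq ?_)
    rw [← ENNReal.ofReal_pow (by norm_num : (0 : ℝ) ≤ 2), ← ENNReal.ofReal_mul (by norm_num),
      ← ENNReal.ofReal_pow hη]
    congr 1
    ring
  rw [eLpNorm_eq_lintegral_rpow_enorm_toReal (by norm_num) (by norm_num)]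
  have h3 : (3 : ℝ≥0∞).toReal = 3 := by norm_num
  rw [h3]
  have hI' : ∫⁻ z, ‖uncurry u z‖ₑ ^ (3 : ℝ)
      ∂(volume.restrict (parabolicCylinder 2 (0 : ℝ × EuclideanSpace ℝ (Fin 3)))) ≤
      ENNReal.ofReal η ^ (3 : ℝ) := by
    have e : ∀ z : ℝ × EuclideanSpace ℝ (Fin 3),
        ‖uncurry u z‖ₑ ^ (3 : ℝ) = ‖u z.1 z.2‖ₑ ^ (3 : ℕ) := by
      intro z
      rw [← ENNReal.rpow_natCast]
      norm_num [uncurry]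
    simp_rw [e]
    rw [← ENNReal.rpow_natCast] at hI
    exact_mod_cast hI
  calc (∫⁻ z, ‖uncurry u z‖ₑ ^ (3 : ℝ)
        ∂(volume.restrict (parabolicCylinder 2 (0 : ℝ × EuclideanSpace ℝ (Fin 3))))) ^
        (1 / (3 : ℝ))
      ≤ (ENNReal.ofReal η ^ (3 : ℝ)) ^ (1 / (3 : ℝ)) := by gcongr
    _ = ENNReal.ofReal η := by
        rw [← ENNReal.rpow_mul]
        norm_num

/-- **Kwon 2023, §4: Lemma 2.5 + Theorem 3.1 ⇒ Theorem 1.4 at unit scale (`r = m = 3`,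
CKN-suitable class, qualitative conclusion).** Suppose
(`h25`, Lemma 2.5 for `r = m = 3` and the class of Def. 1.1 / Scheffer) that there is `C₁ > 0`
such that every suitable weak solution `(u, p)` of Navier–Stokes (`ν = 1`, `f = 0`) on
`Q₂(0) = (−4,0) × B₂` with `esssup_t 2⁻¹∫_{B₂}|u|² < ∞`, a weak spatial gradient `G` with
`2⁻¹∬_{Q₂}|G|² < ∞`, `2⁻²∬_{Q₂}|p|^{3/2} < ∞` and `2⁻²∬_{Q₂}|u|³ < ∞` decomposes as
`u = v + h` a.e. on `Q₁(0)`, where `(v, q)` is a suitable weak solution of the perturbed system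
(per.NS) (`λ = 1`) on `Q₁(0)` with drift `h` (weak spatial gradient `Dh`) and force `f` in the
sense of Def. 2.4, `h` is essentially bounded on `Q_{1/2}(0)` ((est.h) with `r = ∞`, `k = 0`,
and `u ∈ L^∞_t L²_x`), and, with `N = ‖u‖_{L³(Q₂)}`: `‖v‖_{L³(Q₁)} ≤ C₁N` ((est.v)),
`‖q‖_{L^{3/2}(Q₁)} ≤ C₁N²` ((est.q)), `‖h‖_{L³_t W^{1,∞}_x(Q₁)} ≤ C₁N` ((est.h)),
`‖f‖_{L^{3/2}_t L^∞_x(Q₁)} ≤ C₁(N + N²)` ((est.f) with Hölder on `B₂`); and suppose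
(`h31`, Thm. 3.1 for `r = m = 3`, conclusion weakened from `‖v‖_{C^α_par(Q_{1/2})} ≤ C` to
essential boundedness) that there is `ε₀ > 0` such that every suitable weak solution `(v, q)`
of (per.NS) on `Q₁(0)` with drift `h` and force `f` (Def. 2.4; `div h = div f = 0` are part of
the notion) satisfying
`‖v‖_{L³(Q₁)}, ‖q‖_{L^{3/2}(Q₁)}, ‖h‖_{L³_tW^{1,∞}_x(Q₁)}, ‖f‖_{L^{3/2}_tL^∞_x(Q₁)} ≤ ε₀`
is essentially bounded on `Q_{1/2}(0)`. Then there is `ε > 0` such that every suitable weak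
solution on `Q₂(0)` in the above classes with `2⁻²∬_{Q₂}|u|³ ≤ ε` is essentially bounded on
`Q_{1/2}(0)`: "if we choose a positive constant `ε` such that `C₂(ε + ε²) ≤ ε₀` … we have
`‖v‖_{C^α_par(Q_{1/2})} ≤ C`", and `u = v + h` with `h` bounded there.
[cite: Kwon2023RolePressure, §4 (proof of Thm. 1.4, arXiv p. 15) with Lemma 2.5 and Thm. 3.1] -/
theorem kwon2023_unitScale_of_lemma25_of_thm31
    (h25 : ∃ C₁ : ℝ, 0 < C₁ ∧
      ∀ (u : ℝ → EuclideanSpace ℝ (Fin 3) → EuclideanSpace ℝ (Fin 3))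
        (p : ℝ → EuclideanSpace ℝ (Fin 3) → ℝ),
      IsSuitableWeakSolutionOn (parabolicCylinderOpens 2 0) 1 0 u p →
      cknAEss 2 0 u < ⊤ →
      (∃ G : ℝ → EuclideanSpace ℝ (Fin 3) →
          EuclideanSpace ℝ (Fin 3) →L[ℝ] EuclideanSpace ℝ (Fin 3),
        HasWeakSpatialGradientOn (parabolicCylinderOpens 2 0) u G ∧ cknE 2 0 G < ⊤) →
      cknD 2 (0 : ℝ × EuclideanSpace ℝ (Fin 3)) p < ⊤ →
      cknC 2 0 u < ⊤ →
      ∃ (v h f : ℝ → EuclideanSpace ℝ (Fin 3) → EuclideanSpace ℝ (Fin 3))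
        (Dh : ℝ → EuclideanSpace ℝ (Fin 3) →
          EuclideanSpace ℝ (Fin 3) →L[ℝ] EuclideanSpace ℝ (Fin 3))
        (q : ℝ → EuclideanSpace ℝ (Fin 3) → ℝ),
        (∀ᵐ z : ℝ × EuclideanSpace ℝ (Fin 3) ∂(volume.restrict (parabolicCylinder 1 0)),
          u z.1 z.2 = v z.1 z.2 + h z.1 z.2) ∧
        Kwon2023.IsPerturbedSuitableOn (parabolicCylinderOpens 1 0) 1 h Dh f v q ∧
        eLpNorm (uncurry h) ∞ (volume.restrict (parabolicCylinder (1 / 2) 0)) < ⊤ ∧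
        eLpNorm (uncurry v) 3 (volume.restrict (parabolicCylinder 1 0)) ≤
          ENNReal.ofReal C₁ * eLpNorm (uncurry u) 3 (volume.restrict (parabolicCylinder 2 0)) ∧
        eLpNorm (uncurry q) (3 / 2) (volume.restrict (parabolicCylinder 1 0)) ≤
          ENNReal.ofReal C₁ *
            eLpNorm (uncurry u) 3 (volume.restrict (parabolicCylinder 2 0)) ^ 2 ∧
        (∫⁻ t in Ioo (-1 : ℝ) 0, (eLpNorm (h t) ∞ (volume.restrict (ball 0 1)) +
            eLpNorm (Dh t) ∞ (volume.restrict (ball 0 1))) ^ (3 : ℝ)) ^ (1 / 3 : ℝ) ≤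
          ENNReal.ofReal C₁ * eLpNorm (uncurry u) 3 (volume.restrict (parabolicCylinder 2 0)) ∧
        (∫⁻ t in Ioo (-1 : ℝ) 0,
            eLpNorm (f t) ∞ (volume.restrict (ball 0 1)) ^ (3 / 2 : ℝ)) ^ (2 / 3 : ℝ) ≤
          ENNReal.ofReal C₁ *
            (eLpNorm (uncurry u) 3 (volume.restrict (parabolicCylinder 2 0)) +
              eLpNorm (uncurry u) 3 (volume.restrict (parabolicCylinder 2 0)) ^ 2))
    (h31 : ∃ ε₀ : ℝ, 0 < ε₀ ∧
      ∀ (v h f : ℝ → EuclideanSpace ℝ (Fin 3) → EuclideanSpace ℝ (Fin 3))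
        (Dh : ℝ → EuclideanSpace ℝ (Fin 3) →
          EuclideanSpace ℝ (Fin 3) →L[ℝ] EuclideanSpace ℝ (Fin 3))
        (q : ℝ → EuclideanSpace ℝ (Fin 3) → ℝ),
      Kwon2023.IsPerturbedSuitableOn (parabolicCylinderOpens 1 0) 1 h Dh f v q →
      eLpNorm (uncurry v) 3 (volume.restrict (parabolicCylinder 1 0)) ≤ ENNReal.ofReal ε₀ →
      eLpNorm (uncurry q) (3 / 2) (volume.restrict (parabolicCylinder 1 0)) ≤
        ENNReal.ofReal ε₀ →
      (∫⁻ t in Ioo (-1 : ℝ) 0, (eLpNorm (h t) ∞ (volume.restrict (ball 0 1)) +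
          eLpNorm (Dh t) ∞ (volume.restrict (ball 0 1))) ^ (3 : ℝ)) ^ (1 / 3 : ℝ) ≤
        ENNReal.ofReal ε₀ →
      (∫⁻ t in Ioo (-1 : ℝ) 0,
          eLpNorm (f t) ∞ (volume.restrict (ball 0 1)) ^ (3 / 2 : ℝ)) ^ (2 / 3 : ℝ) ≤
        ENNReal.ofReal ε₀ →
      eLpNorm (uncurry v) ∞ (volume.restrict (parabolicCylinder (1 / 2) 0)) < ⊤) :
    ∃ ε : ℝ, 0 < ε ∧
      ∀ (u : ℝ → EuclideanSpace ℝ (Fin 3) → EuclideanSpace ℝ (Fin 3))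
        (p : ℝ → EuclideanSpace ℝ (Fin 3) → ℝ),
      IsSuitableWeakSolutionOn
          (parabolicCylinderOpens 2 (0 : ℝ × EuclideanSpace ℝ (Fin 3))) 1 0 u p →
      cknAEss 2 (0 : ℝ × EuclideanSpace ℝ (Fin 3)) u < ⊤ →
      (∃ G : ℝ → EuclideanSpace ℝ (Fin 3) →
          EuclideanSpace ℝ (Fin 3) →L[ℝ] EuclideanSpace ℝ (Fin 3),
        HasWeakSpatialGradientOn
            (parabolicCylinderOpens 2 (0 : ℝ × EuclideanSpace ℝ (Fin 3))) u G ∧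
          cknE 2 (0 : ℝ × EuclideanSpace ℝ (Fin 3)) G < ⊤) →
      cknD 2 (0 : ℝ × EuclideanSpace ℝ (Fin 3)) p < ⊤ →
      cknC 2 (0 : ℝ × EuclideanSpace ℝ (Fin 3)) u ≤ ENNReal.ofReal ε →
      eLpNorm (uncurry u) ∞ (volume.restrict
        (parabolicCylinder (1 / 2) (0 : ℝ × EuclideanSpace ℝ (Fin 3)))) < ⊤ := by
  obtain ⟨C₁, hC₁, H1⟩ := h25
  obtain ⟨ε₀, hε₀, H2⟩ := h31
  -- ### the printed choice of `ε`: `‖u‖_{L³(Q₂)} ≤ η` with `C₁η, C₁η², C₁(η + η²) ≤ ε₀`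
  set η : ℝ := min 1 (ε₀ / (2 * C₁)) with hη_def
  have hη : 0 < η := lt_min one_pos (by positivity)
  have hη1 : η ≤ 1 := min_le_left _ _
  have hηε : 2 * C₁ * η ≤ ε₀ := by
    have : η ≤ ε₀ / (2 * C₁) := min_le_right _ _
    rwa [le_div_iff₀ (by positivity), mul_comm] at this
  refine ⟨η ^ 3 / 4, by positivity, fun u p hsol hA hG hD hC => ?_⟩
  -- ### Lemma 2.5
  have hCfin : cknC 2 (0 : ℝ × EuclideanSpace ℝ (Fin 3)) u < ⊤ :=
    lt_of_le_of_lt hC ENNReal.ofReal_lt_top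
  obtain ⟨v, h, f, Dh, q, hae, hper, hh, hv, hq, hdrift, hforce⟩ :=
    H1 u p hsol hA hG hD hCfin
  -- ### the smallness of `N = ‖u‖_{L³(Q₂)}` and of the four norms of Thm. 3.1
  set N : ℝ≥0∞ := eLpNorm (uncurry u) 3
    (volume.restrict (parabolicCylinder 2 (0 : ℝ × EuclideanSpace ℝ (Fin 3)))) with hN_def
  have hN : N ≤ ENNReal.ofReal η := eLpNorm_three_le_of_cknC_two_le hη.le hC
  have hN2 : N ^ 2 ≤ ENNReal.ofReal η := by
    calc N ^ 2 ≤ ENNReal.ofReal η ^ 2 := by gcongr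
      _ = ENNReal.ofReal (η ^ 2) := (ENNReal.ofReal_pow hη.le 2).symm
      _ ≤ ENNReal.ofReal η := ENNReal.ofReal_le_ofReal (by nlinarith)
  have hlin : ENNReal.ofReal C₁ * ENNReal.ofReal η ≤ ENNReal.ofReal ε₀ := by
    rw [← ENNReal.ofReal_mul hC₁.le]
    exact ENNReal.ofReal_le_ofReal (by nlinarith)
  have hsum : ENNReal.ofReal C₁ * (ENNReal.ofReal η + ENNReal.ofReal η) ≤
      ENNReal.ofReal ε₀ := by
    rw [← ENNReal.ofReal_add hη.le hη.le, ← ENNReal.ofReal_mul hC₁.le]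
    exact ENNReal.ofReal_le_ofReal (by nlinarith)
  have hv' := hv.trans ((mul_le_mul_right hN _).trans hlin)
  have hq' := hq.trans ((mul_le_mul_right hN2 _).trans hlin)
  have hdrift' := hdrift.trans ((mul_le_mul_right hN _).trans hlin)
  have hforce' := hforce.trans ((mul_le_mul_right (add_le_add hN hN2) _).trans hsum)
  -- ### Theorem 3.1, and `u = v + h` on `Q_{1/2}(0) ⊆ Q₁(0)`
  have hvbd := H2 v h f Dh q hper hv' hq' hdrift' hforce'
  have hae' : uncurry u =ᵐ[volume.restrict
      (parabolicCylinder (1 / 2) (0 : ℝ × EuclideanSpace ℝ (Fin 3)))]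
      uncurry v + uncurry h := by
    have h1 := ae_restrict_of_ae_restrict_of_subset parabolicCylinder_half_subset_one hae
    filter_upwards [h1] with z hz
    simpa [uncurry] using hz
  rw [eLpNorm_congr_ae hae', eLpNorm_exponent_top]
  refine lt_of_le_of_lt eLpNormEssSup_add_le ?_
  rw [← eLpNorm_exponent_top, ← eLpNorm_exponent_top]
  exact ENNReal.add_lt_top.2 ⟨hvbd, hh⟩

/-- **Kwon 2023, Thm. 1.4 (`r = m = 3`, suitable weak solutions) from its two printed
inputs.** Under the hypotheses `h25` (Lemma 2.5, cubic case, CKN-suitable class on `Q₂(0)`)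
and `h31` (Thm. 3.1, cubic case on `Q₁(0)`, `L^∞` conclusion) of
`kwon2023_unitScale_of_lemma25_of_thm31`, the named fact
`kwon2023_velocity_epsilon_regularity` holds: §4 gives the unit-scale statement on
`Q₂(0) → Q_{1/2}(0)`, and the accepted scaling reduction
`kwon2023_velocity_epsilon_regularity_of_two` ("Due to the translation and scale invariance of
the Navier–Stokes equations, one can work on `Q₁` without loss of generality", §1 p. 1)
transports it to every cylinder `Q_ρ(z₀) → Q_{ρ/4}(z₀)`.
[cite: Kwon2023RolePressure, Thm. 1.4 = Lemma 2.5 + Thm. 3.1 (§4, arXiv p. 15), §1 p. 1] -/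
theorem kwon2023_velocity_epsilon_regularity_of_lemma25_of_thm31
    (h25 : ∃ C₁ : ℝ, 0 < C₁ ∧
      ∀ (u : ℝ → EuclideanSpace ℝ (Fin 3) → EuclideanSpace ℝ (Fin 3))
        (p : ℝ → EuclideanSpace ℝ (Fin 3) → ℝ),
      IsSuitableWeakSolutionOn (parabolicCylinderOpens 2 0) 1 0 u p →
      cknAEss 2 0 u < ⊤ →
      (∃ G : ℝ → EuclideanSpace ℝ (Fin 3) →
          EuclideanSpace ℝ (Fin 3) →L[ℝ] EuclideanSpace ℝ (Fin 3),
        HasWeakSpatialGradientOn (parabolicCylinderOpens 2 0) u G ∧ cknE 2 0 G < ⊤) →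
      cknD 2 (0 : ℝ × EuclideanSpace ℝ (Fin 3)) p < ⊤ →
      cknC 2 0 u < ⊤ →
      ∃ (v h f : ℝ → EuclideanSpace ℝ (Fin 3) → EuclideanSpace ℝ (Fin 3))
        (Dh : ℝ → EuclideanSpace ℝ (Fin 3) →
          EuclideanSpace ℝ (Fin 3) →L[ℝ] EuclideanSpace ℝ (Fin 3))
        (q : ℝ → EuclideanSpace ℝ (Fin 3) → ℝ),
        (∀ᵐ z : ℝ × EuclideanSpace ℝ (Fin 3) ∂(volume.restrict (parabolicCylinder 1 0)),
          u z.1 z.2 = v z.1 z.2 + h z.1 z.2) ∧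
        Kwon2023.IsPerturbedSuitableOn (parabolicCylinderOpens 1 0) 1 h Dh f v q ∧
        eLpNorm (uncurry h) ∞ (volume.restrict (parabolicCylinder (1 / 2) 0)) < ⊤ ∧
        eLpNorm (uncurry v) 3 (volume.restrict (parabolicCylinder 1 0)) ≤
          ENNReal.ofReal C₁ * eLpNorm (uncurry u) 3 (volume.restrict (parabolicCylinder 2 0)) ∧
        eLpNorm (uncurry q) (3 / 2) (volume.restrict (parabolicCylinder 1 0)) ≤
          ENNReal.ofReal C₁ *
            eLpNorm (uncurry u) 3 (volume.restrict (parabolicCylinder 2 0)) ^ 2 ∧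
        (∫⁻ t in Ioo (-1 : ℝ) 0, (eLpNorm (h t) ∞ (volume.restrict (ball 0 1)) +
            eLpNorm (Dh t) ∞ (volume.restrict (ball 0 1))) ^ (3 : ℝ)) ^ (1 / 3 : ℝ) ≤
          ENNReal.ofReal C₁ * eLpNorm (uncurry u) 3 (volume.restrict (parabolicCylinder 2 0)) ∧
        (∫⁻ t in Ioo (-1 : ℝ) 0,
            eLpNorm (f t) ∞ (volume.restrict (ball 0 1)) ^ (3 / 2 : ℝ)) ^ (2 / 3 : ℝ) ≤
          ENNReal.ofReal C₁ *
            (eLpNorm (uncurry u) 3 (volume.restrict (parabolicCylinder 2 0)) +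
              eLpNorm (uncurry u) 3 (volume.restrict (parabolicCylinder 2 0)) ^ 2))
    (h31 : ∃ ε₀ : ℝ, 0 < ε₀ ∧
      ∀ (v h f : ℝ → EuclideanSpace ℝ (Fin 3) → EuclideanSpace ℝ (Fin 3))
        (Dh : ℝ → EuclideanSpace ℝ (Fin 3) →
          EuclideanSpace ℝ (Fin 3) →L[ℝ] EuclideanSpace ℝ (Fin 3))
        (q : ℝ → EuclideanSpace ℝ (Fin 3) → ℝ),
      Kwon2023.IsPerturbedSuitableOn (parabolicCylinderOpens 1 0) 1 h Dh f v q →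
      eLpNorm (uncurry v) 3 (volume.restrict (parabolicCylinder 1 0)) ≤ ENNReal.ofReal ε₀ →
      eLpNorm (uncurry q) (3 / 2) (volume.restrict (parabolicCylinder 1 0)) ≤
        ENNReal.ofReal ε₀ →
      (∫⁻ t in Ioo (-1 : ℝ) 0, (eLpNorm (h t) ∞ (volume.restrict (ball 0 1)) +
          eLpNorm (Dh t) ∞ (volume.restrict (ball 0 1))) ^ (3 : ℝ)) ^ (1 / 3 : ℝ) ≤
        ENNReal.ofReal ε₀ →
      (∫⁻ t in Ioo (-1 : ℝ) 0,
          eLpNorm (f t) ∞ (volume.restrict (ball 0 1)) ^ (3 / 2 : ℝ)) ^ (2 / 3 : ℝ) ≤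
        ENNReal.ofReal ε₀ →
      eLpNorm (uncurry v) ∞ (volume.restrict (parabolicCylinder (1 / 2) 0)) < ⊤) :
    kwon2023_velocity_epsilon_regularity :=
  kwon2023_velocity_epsilon_regularity_of_two (kwon2023_unitScale_of_lemma25_of_thm31 h25 h31)

end Literature.Analysis.FluidPDE

end
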